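import Literature.NumberTheory.EllipticCurves.ZpExtensionEisensteinResidualInvolutionTransportProofs
import Literature.NumberTheory.EllipticCurves.ZpExtensionEisensteinDVRSetting
import HarnessLib

/-!
# H.5(b) at tower level `0` and a place `v ∣ p` from the torsion-cut readout of `F̄_𝔮` at `v` and `σ v`
# (the transport step of the «uniform involution» road; theorems only — no definition, no named fact, no instance, no `sorry`)

Topic `NumberTheory/EllipticCurves` (D1 road of cell `pub/bsd-print-x9`; brick (H5B-P-ANOM) of `Stmt.h5bAtS`, road U of seat
`bsd-line-x9-p1-w3` g6, file F7b-core).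

B. Howard, *The Heegner point Kolyvagin system*, Compositio Math. 140 (2004), §1.3 H.5(b) (arXiv:1202.6340 p. 7 L96–97):
`(θ_v ∘ transport_v)(F̄_𝔮(σ v)) = F̄_𝔮(v)`.  For the curve's Eisenstein setting `WeierstrassCurve.eisensteinDVRSetting` at
tower level `0` and a place `v` such that at BOTH `w = v` and `w = σ v` the residual image `F̄_𝔮(w) ⊆ H¹(K_w, E[p])` is the
`π̄_w`-image of the TORSION CUT `{y ∈ H¹(K_w, W₁) : [T]^r y ∈ H¹_str(K_w, Fil_w W₁)}` of `W₁ = E[p] ⊗ A_{m,1}(ψ)` (hypothesis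
`hread`; supplied WITHOUT non-anomalous hypotheses by `ZpExtensionEisensteinOrdinaryTorsionCutReadoutProofs` for
`m ≥ 5p^s + 1`), and `κ` anticyclotomic for the conjugation, the clause holds:
**`eisensteinDVRSetting_h5b_clause_zero_of_torsionCut_readout`**.  Proof: the `Γ_K`-equivariant `ι₁`-semilinear involution
`Θ₁ = ι₁ ⊗ τ` of `W₁` (`ZpExtensionEisensteinResidualInvolutionTransportProofs`): `Ψ_v = H¹(Θ₁) ∘ transport_v` carries the cut at
`σ v` onto the cut at `v` (`map_thetaH1_transportH1_torsionCut_eq`, `τ(Fil_{σv} E[p]) = Fil_v E[p]`) and covers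
`θ_v ∘ transport_v` under `π̄` (`map_cohomologyMap_πbar_thetaH1_transportH1`, `π̄ ∘ Θ₁ = θ ∘ π̄`).
No summit statement is proved; BSD is not proved by any of this.

References: [Howard2004HeegnerKolyvagin] §1.3 H.5(b), Def. 3.1.2, §3.1–3.2, Lemma 3.2.7; [MazurTateTeitelbaum1986Invent] Ch. I §17;
[SerreGaloisCohomology1997] I §2.4, §5.8; [GreenbergLNM1716] §2.
-/

set_option autoImplicit false

noncomputable section

open Function NumberField IsDedekindDomain Field
open scoped NumberField TensorProduct ContRepresentation

namespace WeierstrassCurve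

open Literature.NumberTheory.EllipticCurves Literature.NumberTheory.GaloisRepresentations
open Literature.NumberTheory.GaloisRepresentations.DiscreteGaloisModule
open Literature.NumberTheory.GaloisCohomology.Howard2004
open Literature.NumberTheory.EllipticCurves.IwasawaAlgebra Literature.NumberTheory.EllipticCurves.ZpExtension

variable {K : Type} [Field K] [NumberField K] (W : WeierstrassCurve ℚ) [W.IsElliptic] {p : ℕ} [hp : Fact p.Prime]
  (κ : ZpExtension K p) {m : ℕ} (hm : 1 ≤ m)
  (S : Finset (HeightOneSpectrum (𝓞 K)))
  (hpS : ∀ v : HeightOneSpectrum (𝓞 K), ((p : ℕ) : 𝓞 K) ∈ v.asIdeal → v ∈ S)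
  (hbad : ∀ v : HeightOneSpectrum (𝓞 K), v ∉ S → ((p : ℕ) : 𝓞 K) ∉ v.asIdeal → (W.baseChange K).HasGoodReductionAt v)
  (L : Set (HeightOneSpectrum (𝓞 K)))
  (hL : letI := IwasawaAlgebra.isLocalRing_quotient_X_pow_add_C p hm
    L ⊆ (W.eisensteinTower κ hm).degreeTwoPrimes p)
  (hLS : ∀ v ∈ L, v ∉ S)
  (jbar : AlgebraicClosure K →+* ℂ)
  (σ : K ≃ₐ[ℚ] K) (hσ₁ : σ ≠ 1) (hσ : σ * σ = 1) (τ : AlgebraicClosure K ≃+* AlgebraicClosure K)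
  (hτ : IsLiftOfAut σ τ) (hτ₂ : Function.Involutive τ)
  (D : letI := IwasawaAlgebra.isLocalRing_quotient_X_pow_add_C p hm
    ∀ k, DualityDatum p (ConjugationDatum.ofLifts σ hσ₁ hσ τ hτ hτ₂) ((W.eisensteinTower κ hm).ρ k)
      (IwasawaAlgebra.EisensteinCoeff p m (k + 1)))
  (fs : letI := IwasawaAlgebra.isLocalRing_quotient_X_pow_add_C p hm
    ∀ (k : ℕ) (n : Finset (HeightOneSpectrum (𝓞 K))) (v : HeightOneSpectrum (𝓞 K)),
      galoisCohomology ((W.eisensteinLevelQuot κ hm k n).toLocal (Sum.inr v)) 1 →+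
        SingularQuotient (GaloisRep.toLocal v (W.eisensteinLevelQuot κ hm k n)) ⊗[ℤ] Gell v)

/-- **H.5(b), bottom level, at `v ∣ p`, from the torsion-cut readout at `v` and `σ v`** (the `hfin` clause of
`eisensteinDVRSetting_h5b_of` at `k = 0`, conjugation datum `ConjugationDatum.ofLifts σ …`, `κ` anticyclotomic for it): if at
`w = v` and at `w = σ v` the propagated condition `F̄_𝔮(w)` is the `π̄_w`-image of the torsion cut of `W₁` with one exponent `r`
(`hread`), then `(θ_v ∘ transport_v)(F̄_𝔮(σ v)) = F̄_𝔮(v)`.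
[cite: Howard2004HeegnerKolyvagin, §1.3 H.5(b), Def. 3.1.2, §3.1–3.2 and Lemma 3.2.7 (arXiv:1202.6340 p. 7 L93–97 and L108–113, p. 15 L99–108, p. 16 L5–6 and L116–123)]
[cite: MazurTateTeitelbaum1986Invent, Ch. I §17] [cite: SerreGaloisCohomology1997, I §2.4 and §5.8] [cite: GreenbergLNM1716, §2] -/
theorem eisensteinDVRSetting_h5b_clause_zero_of_torsionCut_readout {v : HeightOneSpectrum (𝓞 K)}
    (hanti : ∀ g : absoluteGaloisGroup K,
      (κ ((ConjugationDatum.ofLifts σ hσ₁ hσ τ hτ hτ₂).conj g)).toAdd = -(κ g).toAdd)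
    {r : ℕ}
    (hread : ∀ w ∈ ({v, (ConjugationDatum.ofLifts σ hσ₁ hσ τ hτ hτ₂).σ • v} : Set (HeightOneSpectrum (𝓞 K))),
      letI := IwasawaAlgebra.isDomain_quotient_X_pow_add_C p hm
      letI := IwasawaAlgebra.isDiscreteValuationRing_quotient_X_pow_add_C p hm
      haveI := IwasawaAlgebra.EisensteinCoeff.isLocalRing_succ p hm
      letI := IwasawaAlgebra.EisensteinCoeff.algebraOfSpecSucc p m
      haveI := W.isScalarTower_algebraOfSpecSucc (K := K) (p := p) (m := m)
      letI := W.residueModuleSucc (K := K) (p := p) hm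
      ((W.isQuotientBy_eisensteinDVRSetting_πbar κ hm S hpS hbad L hL hLS jbar
          (ConjugationDatum.ofLifts σ hσ₁ hσ τ hτ hτ₂) D fs 0).propagateStructure
        (W.eisensteinTowerTriple κ hm S hpS hbad L hL hLS 0).cond) (Sum.inr w) =
      ((((κ.eisensteinTwist ((W.baseChange K).torsionGaloisModule ((p : ℤ) ^ 1)) hm 1).toLocal (Sum.inr w)).strictSubgroup
          (((W.baseChange K).ordinaryFiltrationAt w (fun j ↦ (W.baseChange K).torsionGaloisModuleReduce p j)
            (fun _ _ ↦ rfl)).twistedFil (p := p) (m := m) 1)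
          (fun g _ hx ↦ ((W.baseChange K).ordinaryFiltrationAt w (fun j ↦ (W.baseChange K).torsionGaloisModuleReduce p j)
            (fun _ _ ↦ rfl)).twistedFil_le_comap hm 1 g hx)).comap
        (galoisCohomology.scalarMapH1 _
          ((κ.isScalarLinear_eisensteinTwist ((W.baseChange K).torsionGaloisModule ((p : ℤ) ^ 1)) hm 1).restrictField _)
          ((Ideal.Quotient.mk _ PowerSeries.X : EisensteinCoeff p m 1) ^ r))).map
        ((W.isQuotientBy_eisensteinDVRSetting_πbar κ hm S hpS hbad L hL hLS jbar
          (ConjugationDatum.ofLifts σ hσ₁ hσ τ hτ hτ₂) D fs 0).localCohomologyMap (Sum.inr w) 1)) :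
    letI := IwasawaAlgebra.isDomain_quotient_X_pow_add_C p hm
    letI := IwasawaAlgebra.isDiscreteValuationRing_quotient_X_pow_add_C p hm
    haveI := IwasawaAlgebra.EisensteinCoeff.isLocalRing_succ p hm
    letI := IwasawaAlgebra.EisensteinCoeff.algebraOfSpecSucc p m
    haveI := W.isScalarTower_algebraOfSpecSucc (K := K) (p := p) (m := m)
    letI := W.residueModuleSucc (K := K) (p := p) hm
    AddSubgroup.map
        (((W.residualTauGeomTorsion (p := p) (ConjugationDatum.ofLifts σ hσ₁ hσ τ hτ hτ₂) hm (k := 0 + 1)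
            (Nat.succ_pos 0)).thetaH1 (Sum.inr v)).comp
          ((ConjugationDatum.ofLifts σ hσ₁ hσ τ hτ hτ₂).transportH1 ((W.baseChange K).torsionGaloisModule (p : ℤ)) v))
        (((W.isQuotientBy_eisensteinDVRSetting_πbar κ hm S hpS hbad L hL hLS jbar
            (ConjugationDatum.ofLifts σ hσ₁ hσ τ hτ hτ₂) D fs 0).propagateStructure
          (W.eisensteinTowerTriple κ hm S hpS hbad L hL hLS 0).cond)
          (Sum.inr ((ConjugationDatum.ofLifts σ hσ₁ hσ τ hτ hτ₂).σ • v))) =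
      ((W.isQuotientBy_eisensteinDVRSetting_πbar κ hm S hpS hbad L hL hLS jbar
          (ConjugationDatum.ofLifts σ hσ₁ hσ τ hτ hτ₂) D fs 0).propagateStructure
        (W.eisensteinTowerTriple κ hm S hpS hbad L hL hLS 0).cond) (Sum.inr v) := by
  letI := IwasawaAlgebra.isDomain_quotient_X_pow_add_C p hm
  letI := IwasawaAlgebra.isDiscreteValuationRing_quotient_X_pow_add_C p hm
  haveI := IwasawaAlgebra.EisensteinCoeff.isLocalRing_succ p hm
  letI := IwasawaAlgebra.EisensteinCoeff.algebraOfSpecSucc p m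
  haveI := W.isScalarTower_algebraOfSpecSucc (K := K) (p := p) (m := m)
  letI := W.residueModuleSucc (K := K) (p := p) hm
  rw [hread _ (by simp), hread _ (by simp)]
  -- the involution `Θ₁ = ι₁ ⊗ τ` of `W₁` and the residual presentation `π̄ = πbar 0`
  obtain ⟨Θ, hΘ⟩ := W.exists_residualInvol (p := p) (m := m) (ConjugationDatum.ofLifts σ hσ₁ hσ τ hτ hτ₂)
  have hbar := W.isQuotientBy_eisensteinDVRSetting_πbar κ hm S hpS hbad L hL hLS jbar
    (ConjugationDatum.ofLifts σ hσ₁ hσ τ hτ hτ₂) D fs 0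
  have hπb : ∀ (d : EisensteinCoeff p m 1) (a : geomTorsion (W.baseChange K) ((p : ℤ) ^ 1)),
      (((W.eisensteinDVRSetting κ hm S hpS hbad L hL hLS jbar (ConjugationDatum.ofLifts σ hσ₁ hσ τ hτ hτ₂) D fs).πbar 0
          (EisensteinCoeff.Twisted.tmul d a) : geomTorsion (W.baseChange K) (p : ℤ)) : geomPoints (W.baseChange K)) =
        (EisensteinCoeff.residueChar p hm (le_refl 1) d).val • (a : geomPoints (W.baseChange K)) := by
    intro d a
    have h1 : EisensteinCoeff.Twisted.tmul d a = d • EisensteinCoeff.Twisted.tmul (1 : EisensteinCoeff p m 1) a := by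
      rw [EisensteinCoeff.Twisted.smul_tmul, mul_one]
    have hone := W.coe_eisensteinDVRSetting_πbar_tmul κ hm S hpS hbad L hL hLS jbar
      (ConjugationDatum.ofLifts σ hσ₁ hσ τ hτ hτ₂) D fs 0 a
    rw [pow_zero, one_smul] at hone
    rw [h1]
    refine (congrArg (fun z : geomTorsion (W.baseChange K) (p : ℤ) ↦ (z : geomPoints (W.baseChange K)))
      (LinearMap.map_smul ((W.eisensteinDVRSetting κ hm S hpS hbad L hL hLS jbar
        (ConjugationDatum.ofLifts σ hσ₁ hσ τ hτ hτ₂) D fs).πbar 0) d (EisensteinCoeff.Twisted.tmul 1 a))).trans ?_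
    refine (congrArg (fun z : geomTorsion (W.baseChange K) (p : ℤ) ↦ (z : geomPoints (W.baseChange K)))
      (EisensteinCoeff.residueModule_smul p hm (Nat.succ_pos 0) _ d _)).trans ?_
    rw [AddSubgroupClass.coe_nsmul, hone]
  have hπbΘ := W.πbar_residualInvol hm (ConjugationDatum.ofLifts σ hσ₁ hσ τ hτ hτ₂) hΘ
    ((W.eisensteinDVRSetting κ hm S hpS hbad L hL hLS jbar (ConjugationDatum.ofLifts σ hσ₁ hσ τ hτ hτ₂) D fs).πbar
      0).toAddMonoidHom hπb
  have hFil : ∀ a : geomTorsion (W.baseChange K) ((p : ℤ) ^ 1),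
      a ∈ ((W.baseChange K).ordinaryFiltrationAt ((ConjugationDatum.ofLifts σ hσ₁ hσ τ hτ hτ₂).σ • v)
          (fun j ↦ (W.baseChange K).torsionGaloisModuleReduce p j) (fun _ _ ↦ rfl)).fil 1 ↔
        (ConjugationDatum.ofLifts σ hσ₁ hσ τ hτ hτ₂).isLift.torsionMap W ((p : ℤ) ^ 1)
            (((W.baseChange K).torsionGaloisModule ((p : ℤ) ^ 1)) ((ConjugationDatum.ofLifts σ hσ₁ hσ τ hτ hτ₂).δ v) a) ∈
          ((W.baseChange K).ordinaryFiltrationAt v (fun j ↦ (W.baseChange K).torsionGaloisModuleReduce p j)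
            (fun _ _ ↦ rfl)).fil 1 := fun a ↦
    W.mem_torsionFilAt_iff_torsionMap_delta_mem_ofLifts σ hσ₁ hσ τ hτ hτ₂ v
      (pow_ne_zero 1 (Int.natCast_ne_zero.mpr hp.out.ne_zero)) a
  have hcut := W.map_thetaH1_transportH1_torsionCut_eq κ hm (ConjugationDatum.ofLifts σ hσ₁ hσ τ hτ hτ₂) hΘ hτ₂ hanti v
    _ _ hFil r
  exact (W.map_cohomologyMap_πbar_thetaH1_transportH1 κ hm (ConjugationDatum.ofLifts σ hσ₁ hσ τ hτ hτ₂) hΘ hanti v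
    (W.residualTauGeomTorsion (p := p) (ConjugationDatum.ofLifts σ hσ₁ hσ τ hτ hτ₂) hm (k := 0 + 1) (Nat.succ_pos 0))
    (fun _ ↦ rfl) _ hπbΘ (fun g x ↦ hbar.equivariant g x) _).symm.trans
    (congrArg (fun X ↦ AddSubgroup.map _ X) hcut)

end WeierstrassCurve

end
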